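import Summits.QuantumFields.YangMills.Theses.RenyiTelescope
import Summits.QuantumFields.YangMills.Theorems.RenyiTelescopeConditionalTelescope
import Summits.QuantumFields.YangMills.Theorems.RenyiTelescopePlaquetteTransport
import Summits.QuantumFields.YangMills.Theorems.RenyiTelescopeUnitEventReduction
import Summits.QuantumFields.YangMills.Theorems.RenyiTelescopeAbstractBootstrap
import Summits.QuantumFields.YangMills.Theorems.RenyiTelescopeInteriorComplement
import Summits.QuantumFields.YangMills.Theorems.RenyiTelescopeTelescopedCrux
import Summits.QuantumFields.YangMills.Theorems.RenyiTelescopeArithClosure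
import Summits.QuantumFields.YangMills.Theorems.RenyiTelescopeGlueRest

/-!
# Crux `HistoryTailL` (stmt-QuantumFields-19936) — LINE «renyi-telescope» (ideator seat ym-r3-idea-2 g3, lens «nearmiss»)

The line IS route `RenyiTelescope` (route-QuantumFields-RenyiTelescope, OPEN): its two cruxes
`CutoffRenyiL` (stmt-QuantumFields-27137, rank 2) and `FineRegimeUnitTailL` (stmt-QuantumFields-27138, rank 3) imply
`UnitScaleTilt.HistoryTailL` through the glue `HistoryTailOfRenyiTelescope` (stmt-QuantumFields-27139), whose eight pieces are ALL
landed in `Theorems/RenyiTelescope*.lean` (p622611, p623159, p623509, p623811, p623983, p624262, p625032, p624729; sorry-free composition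
proposed p625731).  The two stubs below are those cruxes BY NAME (shared items, not re-typed); the composition is kernel-checked.

Mechanism in one paragraph: bound the conditional order-q Rényi divergence between the unit-scale laws of consecutive cut-offs, conditioned
on the interior small-field event, by `(q−1)·R₀·p⁴·L^{3F.m}·L^{−4J}` for orders up to `Q·L^{2J}` (crux 27137 — CLT-scale cumulant control of the
cross-cut-off log-density; lattice-artefact dimension κ = 2 beats the volume exponent 3 after `J₀(d) = d − ⌊d/8⌋` refinements); Hölder-transfer
the unit-plaquette tail DOWN the cut-offs to the fine regime `γ L^J p² ≤ η`, where a Gaussian-type unit tail `C·exp(−a c² p²)` is the base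
(crux 27138); interior masses stay ≥ 1/2 by a bootstrap over the cut-off; transport refined-family unit events back to level-`J` plaquette
events of the original family (`gibbsK_real_eq_refine`) and sum the profile (`historyTailAt_of_bare_finestBad`).

How it differs from the registered lines `birth_v5p*` (LEAD ym-ust-19936): no α-record / χ data rows / (71) small factors — the
large-field input is replaced by an information-theoretic comparison ACROSS cut-offs plus a semiclassical base; the Balaban depth is
concentrated in the two XL stubs, each with its own registered skeleton on its item (bc/CutoffRenyiL_birth.lean: `stub_renyiMomentBound`
open, `stub_holderEvent` ✓p622280; bc/FineRegimeUnitTailL_birth.lean: `stub_fineExpMoment` open, `stub_chernoffUnitPlaquette` ✓p621570).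

WHAT THIS IS NOT: neither stub is proved; `HistoryTailL`, the rung R3 `YM3TorusSU2` and the mass gap are NOT proved.
-/

namespace Summit.QuantumFields.YangMills.Cruxes.HistoryTailL.RenyiTelescope

/-! ## §1 The registered stubs (the ONLY sorries) — the cruxes of route `RenyiTelescope` by name -/

/-- stub (XL, = item stmt-QuantumFields-27137 `CutoffRenyiL`, rank 2 of route `RenyiTelescope`). -/
theorem stub_cutoffRenyi : Summit.QuantumFields.YangMills.Theses.RenyiTelescope.CutoffRenyiL := by
  sorry

/-- stub (XL, = item stmt-QuantumFields-27138 `FineRegimeUnitTailL`, rank 3 of route `RenyiTelescope`). -/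
theorem stub_fineRegimeUnitTail : Summit.QuantumFields.YangMills.Theses.RenyiTelescope.FineRegimeUnitTailL := by
  sorry

/-! ## §2 The crux BY NAME — no sorry below this line (composition of the eight landed glue pieces) -/

/-- The glue, sorry-free: `CutoffRenyiL → FineRegimeUnitTailL → HistoryTailL` (= `Theorems.historyTailOfRenyiTelescope`, p625731). -/
theorem historyTailL_of_cruxes
    (hC : Summit.QuantumFields.YangMills.Theses.RenyiTelescope.CutoffRenyiL)
    (hF : Summit.QuantumFields.YangMills.Theses.RenyiTelescope.FineRegimeUnitTailL) :
    Summit.QuantumFields.YangMills.Theses.UnitScaleTilt.HistoryTailL :=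
  Summit.QuantumFields.YangMills.Theorems.RenyiTelescope.stub_unitEventReduction
    Summit.QuantumFields.YangMills.Theorems.RenyiTelescope.stub_plaquetteTransport
    (Summit.QuantumFields.YangMills.Theorems.RenyiTelescope.stub_glueRest
      (Summit.QuantumFields.YangMills.Theorems.RenyiTelescope.stub_telescopedCrux hC
        Summit.QuantumFields.YangMills.Theorems.RenyiTelescope.stub_conditionalTelescope) hF
      Summit.QuantumFields.YangMills.Theorems.RenyiTelescope.stub_abstractBootstrap
      Summit.QuantumFields.YangMills.Theorems.RenyiTelescope.stub_interiorComplement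
      Summit.QuantumFields.YangMills.Theorems.RenyiTelescope.stub_arithClosure)

/-- The crux of route `UnitScaleTilt` BY NAME, from the two stubs. -/
theorem HistoryTailL_of : Summit.QuantumFields.YangMills.Theses.UnitScaleTilt.HistoryTailL :=
  historyTailL_of_cruxes stub_cutoffRenyi stub_fineRegimeUnitTail

end Summit.QuantumFields.YangMills.Cruxes.HistoryTailL.RenyiTelescope
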